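import Mathlib
import HarnessLib
import Literature.AlgebraicGeometry.GroupActions.KollarSzaboGoingDown
import Summits.ResolutionOfSingularities.ResolutionOfSingularities.Theorems.WildQuotientsWildQuotientResolutionToralEndState
import Summits.ResolutionOfSingularities.ResolutionOfSingularities.Theorems.WildQuotientsWildQuotientResolutionStubPointBlowupStalkData
import Summits.ResolutionOfSingularities.ResolutionOfSingularities.Theorems.WildQuotientsWildQuotientResolutionKSGoingDownLocalStep
import Summits.ResolutionOfSingularities.ResolutionOfSingularities.Theorems.WildQuotientsWildQuotientResolutionKSGoingDownLocalStepOfPrime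
import Summits.ResolutionOfSingularities.ResolutionOfSingularities.Theorems.WildQuotientsWildQuotientResolutionKSGoingDownQuadraticTransformData
import Summits.ResolutionOfSingularities.ResolutionOfSingularities.Theorems.WildQuotientsWildQuotientResolutionKSGoingDownSpecTools

/-!
# Kollár–Szabó «going down» HOLDS: the named fact `KollarSzaboGoingDown` discharged
# (crux `WildQuotients.WildQuotientResolution`, stub `stub_phaseZeroHighDim`)

Crux stmt-ResolutionOfSingularities-15640 (`WildQuotientResolution`), registered stub `stub_phaseZeroHighDim`. The named fact
`Literature.AlgebraicGeometry.GroupActions.KollarSzaboGoingDown` (Reichstein–Youssin 2000, Appendix by Kollár–Szabó, Prop. A.2,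
morphism form: a finite abelian group fixing a regular closed point of `X` fixes a point of every equivariant proper birational
model `Y → X`) is the hypothesis of hand 6-g4's negative side-lemma ✓`StandardForm.not_primeOrbitSeparation_of_commuting_conjugates`
(p824255). This file PROVES it, by assembling:

* the rational-map induction on integral schemes from the LOCAL blow-up step (✓`kollarSzaboGoingDown_of_localStepLE`, this seat);
* the stalk action at the fixed point (✓`PointBlowupStalkData.exists_stalkAction`, ✓`InertLocusStalk.stalkAction_residueTrivial`,
  hand 6 lineage), moved into `K = Frac 𝒪_{X,x}` (Mathlib `IsFractionRing.ringEquivOfRingEquivHom`);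
* the equivariant quadratic transform with all its ring-level data (✓`exists_quadraticTransform_localData`: hand 8-g0's eigenline,
  hand 8-g1's chart origin / equivariant quadratic transform, the tree's quadratic-transform library);
* its `Spec`-side package (✓`localStep_package_ofPrime`) and the dominant equivariant structure map
  `b : Spec R₁ → Spec 𝒪_{X,x} → X` (✓`isDominant_specMap_comp_fromSpecStalk`, ✓`specMap_comm_of_hom_equivariant`).

* `localStepLE_holds` — the local blow-up step.
* ★★★ `kollarSzaboGoingDown_holds : Literature.AlgebraicGeometry.GroupActions.KollarSzaboGoingDown`.

[OURS · crux stmt-ResolutionOfSingularities-15640 · discharge of a NAMED FACT used toward `stub_phaseZeroHighDim` (makes p824255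
unconditional); NOT a proof of the stub or of the crux; counted 0; AI-level work, weaker than expert review.]
[cite: ReichsteinYoussin2000, Appendix (J. Kollár–E. Szabó), Prop. A.2]
-/

-- single-problem summit: the doubled namespace component `ResolutionOfSingularities` is forced
set_option linter.dupNamespace false

noncomputable section

open CategoryTheory AlgebraicGeometry TopologicalSpace IsLocalRing
open Literature.AlgebraicGeometry.Ramification Literature.AlgebraicGeometry.Resolution
open Summit.ResolutionOfSingularities.ResolutionOfSingularities.Theorems.WildQuotientResolution

namespace Summit.ResolutionOfSingularities.ResolutionOfSingularities.Theorems.WildQuotientResolution.KSGoingDown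

set_option maxHeartbeats 1600000 in
/-- **The local blow-up step** (hypothesis of ✓`kollarSzaboGoingDown_of_localStepLE`), PROVED: at a point `x` with `𝒪_{X,x}` regular of
dimension `n + 1`, algebraically closed residue field and `H ≤ I_x` (`H` finite abelian), the equivariant quadratic transform
`R₁ = S[𝔪/t]_𝔫` of `S ≅ 𝒪_{X,x}` gives `X' = Spec R₁ → X` dominant equivariant, `η = (t)` a valuation-ring point, and
`E = Spec (R₁/(t)) ∋ x₁` with `𝒪_{E,x₁}` regular of dimension `≤ n`, algebraically closed residue field and `H ≤ I_{x₁}`.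
[cite: ReichsteinYoussin2000, Appendix, proof of Prop. A.2] -/
theorem localStepLE_holds (K₀ : Type) [Field K₀] [IsAlgClosed K₀] (X : Scheme.{0}) (sX : X ⟶ Spec (.of K₀))
    [IsIntegral X] (H : Type) [CommGroup H] [Finite H] (σ : H →* Aut X) (_hσ : ∀ h, (σ h).hom ≫ sX = sX)
    (x : X) (hreg : IsRegularLocalRing (X.presheaf.stalk x)) (hκ : IsAlgClosed (ResidueField (X.presheaf.stalk x)))
    (hfix : ∀ h, h ∈ inertiaSubgroup σ x) (n : ℕ) (hdim : ringKrullDim (X.presheaf.stalk x) = (n + 1 : ℕ)) :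
    ∃ (X' : Scheme.{0}) (_ : IsIntegral X') (σ' : H →* Aut X') (b : X' ⟶ X) (_ : IsDominant b)
      (_ : ∀ h, (σ' h).hom ≫ b = b ≫ (σ h).hom) (η : X') (_ : ValuationRing (X'.presheaf.stalk η))
      (E : Scheme.{0}) (_ : IsIntegral E) (σE : H →* Aut E) (i : E ⟶ X')
      (_ : ∀ h, (σE h).hom ≫ i = i ≫ (σ' h).hom) (_ : η ∈ Set.range i.base) (x₁ : E),
      IsRegularLocalRing (E.presheaf.stalk x₁) ∧ IsAlgClosed (ResidueField (E.presheaf.stalk x₁)) ∧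
      (∀ h, h ∈ inertiaSubgroup σE x₁) ∧ ringKrullDim (E.presheaf.stalk x₁) ≤ n := by
  classical
  haveI := hreg
  haveI := hκ
  -- the stalk `O = 𝒪_{X,x}` with its action `τ` of `I = ⊤ ≤ H`
  let I : Subgroup H := ⊤
  have hI : ∀ g ∈ I, (σ g).hom.base x = x := fun g _ => apply_eq_of_mem_inertiaSubgroup σ (hfix g)
  obtain ⟨a, τ, hkey, hτ⟩ := PointBlowupStalkData.exists_stalkAction σ x I hI
  have hIle : I ≤ inertiaSubgroup σ x := fun g _ => hfix g
  have hresO : ∀ (g : I) (s : X.presheaf.stalk x), τ g s - s ∈ maximalIdeal (X.presheaf.stalk x) :=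
    InertLocusStalk.stalkAction_residueTrivial σ x a τ hkey hτ hIle
  -- `K = Frac O`, `S = O ⊆ K`
  let O := (X.presheaf.stalk x : Type)
  let K := FractionRing O
  let S : Subring K := (algebraMap O K).range
  have hinj : Function.Injective (algebraMap O K) := IsFractionRing.injective O K
  let e : O ≃+* S := RingEquiv.ofBijective (algebraMap O K).rangeRestrict
    ⟨fun a b h => hinj (congrArg Subtype.val h), (algebraMap O K).rangeRestrict_surjective⟩
  have he : ∀ r : O, ((e r : S) : K) = algebraMap O K r := fun r => rfl
  haveI : IsRegularLocalRing S := IsRegularLocalRing.of_ringEquiv e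
  haveI : IsAlgClosed (ResidueField S) := IsAlgClosed.of_ringEquiv _ _ (ResidueField.mapEquiv e)
  have hSnf : ¬ IsField S := by
    intro hF
    have h0 := ringKrullDim_eq_zero_of_isField hF
    rw [← ringKrullDim_eq_of_ringEquiv e, hdim] at h0
    exact absurd h0 (by exact_mod_cast Nat.succ_ne_zero n)
  -- the action on `K`
  let σK : I →* (K ≃+* K) := (IsFractionRing.ringEquivOfRingEquivHom O K).comp τ
  have hσK : ∀ (g : I) (r : O), σK g (algebraMap O K r) = algebraMap O K (τ g r) := fun g r =>
    IsFractionRing.ringEquivOfRingEquiv_algebraMap (τ g) r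
  have hσS : ∀ g : I, ∀ s ∈ S, σK g s ∈ S := by
    rintro g _ ⟨r, rfl⟩
    rw [hσK]
    exact ⟨_, rfl⟩
  have hresS : ∀ (g : I) (s : S), (⟨σK g s, hσS g s s.2⟩ : S) - s ∈ maximalIdeal S := by
    intro g s
    obtain ⟨r, rfl⟩ := e.surjective s
    have h1 : (⟨σK g (e r), hσS g (e r) (e r).2⟩ : S) = e (τ g r) := by
      apply Subtype.ext
      change σK g ((e r : S) : K) = ((e (τ g r) : S) : K)
      rw [he, he, hσK]
    rw [h1, ← map_sub]
    exact map_nonunit (e : O →+* S) _ (hresO g r)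
  -- the equivariant quadratic transform and its data
  obtain ⟨t, htS, htm, ht2, ht0, 𝔫, h𝔫, ht𝔫, hσR₁, hresR₁, hκ₁, hstabσ⟩ :=
    exists_quadraticTransform_localData S hSnf σK hσS hresS
  haveI := h𝔫
  haveI := hκ₁
  obtain ⟨d, hd⟩ : ∃ d, (maximalIdeal S).spanFinrank = d := ⟨_, rfl⟩
  have hd0 : 0 < d := by
    rw [← hd]
    refine Nat.pos_of_ne_zero fun h0 => hSnf ?_
    rw [Submodule.spanFinrank_eq_zero_iff_eq_bot (IsNoetherian.noetherian _)] at h0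
    exact isField_iff_maximalIdeal_eq.mpr h0
  -- notation-free: `R₁ = S[𝔪/t]_𝔫`
  obtain ⟨τ₁, hτ₁⟩ := EigenlineChart.exists_restrict_ringAut (LocalSubring.ofPrime (blowupRing S t) 𝔫).toSubring σK hσR₁
  have hres₁ := EigenlineChart.restrict_sub_mem_maximalIdeal (LocalSubring.ofPrime (blowupRing S t) 𝔫).toSubring σK τ₁ hτ₁ hresR₁
  have hstab₁ : ∀ (g : I), ∀ r ∈ Ideal.span {(⟨t, LocalSubring.le_ofPrime _ _ (le_blowupRing S t htS)⟩ :
      (LocalSubring.ofPrime (blowupRing S t) 𝔫).toSubring)},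
      τ₁ g r ∈ Ideal.span {(⟨t, LocalSubring.le_ofPrime _ _ (le_blowupRing S t htS)⟩ :
        (LocalSubring.ofPrime (blowupRing S t) 𝔫).toSubring)} := by
    intro g r hr
    have h := hstabσ g (hσR₁ g) r hr
    have heq : τ₁ g r = ⟨σK g r, hσR₁ g r r.2⟩ := Subtype.ext (hτ₁ g r)
    rw [heq]
    exact h
  obtain ⟨ρ₁, hρ₁, η, hη, E, hE, σE, i, hi, hηi, x₁, hx₁reg, hx₁κ, hx₁fix, hx₁dim⟩ :=
    localStep_package_ofPrime S hd hd0 htS htm ht2 ht0 𝔫 ht𝔫 τ₁ hres₁ hstab₁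
  -- `d = n + 1`, so `#{j ≠ 0} ≤ n`
  have hdn : d = n + 1 := by
    have h1 : ((maximalIdeal S).spanFinrank : WithBot ℕ∞) = ringKrullDim S := (isRegularLocalRing_iff S).mp inferInstance
    rw [hd, ← ringKrullDim_eq_of_ringEquiv e, hdim] at h1
    exact_mod_cast h1
  have hcard : Nat.card {j : Fin d // j ≠ ⟨0, hd0⟩} ≤ n := by
    have hlt : Fintype.card {j : Fin d // j ≠ ⟨0, hd0⟩} < Fintype.card (Fin d) :=
      Fintype.card_subtype_lt (p := fun j : Fin d => j ≠ ⟨0, hd0⟩) (x := ⟨0, hd0⟩) (by simp)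
    have hfin : Fintype.card (Fin d) = n + 1 := by rw [Fintype.card_fin]; exact hdn
    rw [Nat.card_eq_fintype_card]
    omega
  have hx₁dim' : ringKrullDim (E.presheaf.stalk x₁) ≤ n :=
    hx₁dim.trans (by exact_mod_cast hcard)
  -- the structure map `b : Spec R₁ → Spec O → X`
  have hSR₁ : S ≤ (LocalSubring.ofPrime (blowupRing S t) 𝔫).toSubring :=
    (le_blowupRing S t).trans (LocalSubring.le_ofPrime _ _)
  let ι : O →+* (LocalSubring.ofPrime (blowupRing S t) 𝔫).toSubring := (Subring.inclusion hSR₁).comp e.toRingHom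
  have hιinj : Function.Injective ι := (Subring.inclusion_injective hSR₁).comp e.injective
  have hιval : ∀ r : O, ((ι r : (LocalSubring.ofPrime (blowupRing S t) 𝔫).toSubring) : K) = algebraMap O K r := fun r => rfl
  let b : Spec (CommRingCat.of (LocalSubring.ofPrime (blowupRing S t) 𝔫).toSubring) ⟶ X :=
    Spec.map (CommRingCat.ofHom ι) ≫ X.fromSpecStalk x
  haveI hbdom : IsDominant b := isDominant_specMap_comp_fromSpecStalk x (CommRingCat.ofHom ι) hιinj
  -- the `Spec` action of `τ` on `Spec O` is `g ↦ Spec (a g)`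
  have hτinv : ∀ (g : I) (r : O), τ g⁻¹ r = (a g).hom r := fun g r => by rw [hτ, inv_inv]
  obtain ⟨ρO, hρO⟩ := exists_specAction_of_hom τ
  have hρOa : ∀ g : I, (ρO g).hom = Spec.map (a g) := by
    intro g
    rw [hρO]
    congr 1
    ext r
    exact hτinv g r
  have hιeq : ∀ (g : I) (r : O), ι (τ g r) = τ₁ g (ι r) := by
    intro g r
    apply Subtype.ext
    rw [hτ₁, hιval, hιval, hσK]
  have hbeq : ∀ g : I, (ρ₁ g).hom ≫ b = b ≫ (σ (g : H)).hom := by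
    intro g
    have h1 := specMap_comm_of_hom_equivariant τ τ₁ ρO hρO ρ₁ hρ₁ ι hιeq g
    change (ρ₁ g).hom ≫ Spec.map (CommRingCat.ofHom ι) ≫ X.fromSpecStalk x =
      (Spec.map (CommRingCat.ofHom ι) ≫ X.fromSpecStalk x) ≫ (σ (g : H)).hom
    rw [← Category.assoc, h1, Category.assoc, hρOa, hkey g, Category.assoc]
  -- pass from `I = ⊤` to `H`
  let j : H →* I := Subgroup.topEquiv.symm.toMonoidHom
  have hj : ∀ h : H, ((j h : I) : H) = h := fun h => rfl
  refine ⟨Spec (CommRingCat.of (LocalSubring.ofPrime (blowupRing S t) 𝔫).toSubring), inferInstance, ρ₁.comp j, b, hbdom,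
    fun h => ?_, η, hη, E, hE, σE.comp j, i, fun h => hi (j h), hηi, x₁, hx₁reg, hx₁κ, fun h => hx₁fix (j h), hx₁dim'⟩
  have := hbeq (j h)
  rw [hj] at this
  exact this

/-- ★★★ **Kollár–Szabó «going down» holds** (the named fact `Literature.AlgebraicGeometry.GroupActions.KollarSzaboGoingDown`,
Reichstein–Youssin 2000, Appendix, Prop. A.2, morphism form), by ✓`kollarSzaboGoingDown_of_localStepLE` and `localStepLE_holds`.
[cite: ReichsteinYoussin2000, Appendix (J. Kollár–E. Szabó), Prop. A.2] -/
theorem kollarSzaboGoingDown_holds : Literature.AlgebraicGeometry.GroupActions.KollarSzaboGoingDown :=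
  kollarSzaboGoingDown_of_localStepLE fun K₀ _ _ X sX _ H _ _ σ hσ x hreg hκ hfix n hdim =>
    localStepLE_holds K₀ X sX H σ hσ x hreg hκ hfix n hdim

end Summit.ResolutionOfSingularities.ResolutionOfSingularities.Theorems.WildQuotientResolution.KSGoingDown

end
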